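import Summits.BirchSwinnertonDyer.Rank1Residual.O5.CongruenceBlockTwist
import HarnessLib

/-!
# O5 pool: BLOCK-TWIN for twin CURVE pairs `(G, G ⊗ χ_{p*})` at a common level `p² ∣ N`
# (the literal shape of T-F2's rows: `f = f_E`, `f^χ = f_{E′}` for an optimal twin pair `E, E′`)

HONEST FRAMING (cell `b2b-bsdres`, run/shared/lean/b2b/bsd-rank1-residual/, verbatim in every
file): the goal of the cell is to DELETE the COMBINATION-SHAPED residual classes of the
Birch–Swinnerton-Dyer formula for ALL analytic-rank `≤ 1` elliptic curves over `ℚ` — assembled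
STRICTLY from published theorems — so that the rank-`≤ 1` remainder becomes exactly the
CONSTRUCTION-SHAPED classes, which are TYPED, NOT attempted. This is not "finishing BSD". Lane
CLASS-CLOSURE, team o5 (planner o5-r2 GEN 7: TWIN-PROOF Addendum "BLOCK TWIN"; BLOCKS-SCHEMA
T-F2 "for every twin pair `(f, f^χ)` in the list …" — 131/131 pairs EVIDENCE, not an input);
prover seat `b2b-bsdres-x11b3-p5` GEN 12 (pool item P5-BT, third file of one target). THEOREMS
ONLY (no definition, no named fact, no `sorry`); nothing booked; no RESIDUAL-MAP mark / label /
count moved; `CongruenceNumberTwin` / R-TW / R-FLAT / E-O5-CONG / N3 / N4 UNTOUCHED and NOT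
discharged; no block defined.

## What

For an odd prime `p`, `p² ∣ N`, elliptic curves `W`, `W'` over `ℚ` with
`C • W.quadraticTwist (pStarRat p) = W'` (`W' ≅ W ⊗ χ_{p*}`, `p* = (−1)^{(p−1)/2} p`) and modular
parametrisation data `D`, `D'` at the SAME level `N`:

* `f_eq_charTwist_twin_prime`: **`D'.f = R D.f`** with `R` the twist by the
  quadratic character `(·/p)` on `S₂(Γ₀(N))` — coefficientwise: `aₙ(W') = (p*/n)·aₙ(W) = (n/p)·aₙ(W)`
  off `p` (`LFunction_quadraticTwist_pStar_apply`, `LFunction_smul`) and both newforms are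
  `p`-depleted (`a_{pm} = 0`, `p² ∣ N`). This is the identity used INSIDE o5's
  `PrimeTwist.congruenceNumber_twin_prime` (TWIN for curves), exported as a lemma.
* **`natCard_blockQuotient_twin_prime`**: for ANY `ℂ`-subspaces `X`, `X′` of `S₂(Γ₀(N))` with
  `R(X) ⊆ X′`, `R(X′) ⊆ X`, the block quotients of `(D.f, X)` and `(D'.f, X′)` have the same order
  (`PrimeTwist.natCard_blockQuotient_charTwist`); `O5.natCard_blockQuotient_twin_three` is the
  case `p = 3`, `W' ≅ W ⊗ χ₋₃`, `9 ∣ N` — the population of the planner's T-F2 (type III / III*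
  optimal twin pairs at `9 ∥ N`), blocks supplied by the reader (`O5/CongruenceBlockTwistDegeneracy`).

References: [AgasheRibetStein2012] §2.1; [Shimura1971] Prop. 3.64; cell files
`HOME/b2b-bsdres-o5-r2/gen7/{TWIN-PROOF.md, BLOCKS-SCHEMA.md}`.
-/

noncomputable section

open scoped MatrixGroups ModularForm

open CongruenceSubgroup Literature.NumberTheory.EllipticCurves.ModularForms WeierstrassCurve

namespace Summit.BirchSwinnertonDyer.Rank1Residual.O5

namespace PrimeTwist

variable {N p : ℕ} [NeZero N] [hp : Fact p.Prime]

/-- **`D'.f = D.f ⊗ (·/p)` for a `p*`-twin pair at a common level `N` with `p² ∣ N`** (`p` odd):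
the newform of `W' ≅ W ⊗ χ_{p*}` is the twist of the newform of `W` by the quadratic character mod
`p` — `aₙ(W') = χ_{p*}(n) aₙ(W) = (n/p) aₙ(W)` for `p ∤ n` (`LFunction_quadraticTwist_pStar_apply`,
`LFunction_smul`), and `aₙ = 0` on both sides for `p ∣ n` (newforms of level `p² ∣ N`). The
identity inside o5's `congruenceNumber_twin_prime`, as a lemma. [cite: Shimura1971, Prop. 3.64]
[cite: AtkinLehner1970, Thm. 3] -/
theorem f_eq_charTwist_twin_prime (hpN : p ^ 2 ∣ N) (hp2 : p ≠ 2)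
    {W W' : WeierstrassCurve ℚ} [W.IsElliptic] [W'.IsElliptic] (C : VariableChange ℚ)
    (hC : C • W.quadraticTwist (pStarRat p) = W') (D : ModularParametrizationData W N)
    (D' : ModularParametrizationData W' N) :
    D'.f = charTwist N dvd_rfl hpN (isQuadratic_quadraticChar_ringHomComp p) D.f := by
  have hprim := isPrimitive_quadraticChar_ringHomComp p hp2
  have hd0 : pStarRat p ≠ 0 := by
    unfold pStarRat
    push_cast
    exact mul_ne_zero (pow_ne_zero _ (by norm_num)) (by exact_mod_cast hp.out.ne_zero)
  haveI : (W.quadraticTwist (pStarRat p)).IsElliptic := W.isElliptic_quadraticTwist hd0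
  refine eq_of_forall_cuspCoeff_eq_gamma0 fun n ↦ ?_
  rw [cuspCoeff_charTwist N _ hpN (isQuadratic_quadraticChar_ringHomComp p) hprim,
    quadraticChar_ringHomComp_apply_natCast]
  by_cases hn : p ∣ n
  · rw [cuspCoeff_eq_zero_of_prime_dvd_of_isNewform0 hpN D'.isNewformOf.1 hn,
      cuspCoeff_eq_zero_of_prime_dvd_of_isNewform0 hpN D.isNewformOf.1 hn, mul_zero]
  · rw [D'.isNewformOf.2 n, D.isNewformOf.2 n, ← hC, WeierstrassCurve.LFunction_smul, pStarRat,
      W.LFunction_quadraticTwist_pStar_apply hp2 hn]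
    push_cast
    ring

/-- **BLOCK-TWIN for a twin curve pair at a common level** (`p` odd, `p² ∣ N`,
`W' ≅ W ⊗ χ_{p*}`, `D`, `D'` parametrisation data at level `N`; `R` the twist by `(·/p)`): for any
`ℂ`-subspaces `X`, `X′` of `S₂(Γ₀(N))` with `R(X) ⊆ X′` and `R(X′) ⊆ X`,
`#((S ⊓ (ℂ D.f ⊔ X)) / (ℤ D.f ⊔ (S ⊓ X))) = #((S ⊓ (ℂ D'.f ⊔ X′)) / (ℤ D'.f ⊔ (S ⊓ X′)))` — the
shape of every T-F2 row `r(f_E;X) = r(f_{E′};X′)` (`D'.f = R D.f`, `f_E` `p`-depleted). No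
conductor / minimality / optimality binder. [cite: AgasheRibetStein2012, §2.1]
[cite: Shimura1971, Prop. 3.64] -/
theorem natCard_blockQuotient_twin_prime (hpN : p ^ 2 ∣ N) (hp2 : p ≠ 2)
    {W W' : WeierstrassCurve ℚ} [W.IsElliptic] [W'.IsElliptic] (C : VariableChange ℚ)
    (hC : C • W.quadraticTwist (pStarRat p) = W') (D : ModularParametrizationData W N)
    (D' : ModularParametrizationData W' N) {X X' : Submodule ℂ (CuspForm (Gamma0 N) 2)}
    (hX : ∀ x ∈ X, charTwist N dvd_rfl hpN (isQuadratic_quadraticChar_ringHomComp p) x ∈ X')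
    (hX' : ∀ x ∈ X', charTwist N dvd_rfl hpN (isQuadratic_quadraticChar_ringHomComp p) x ∈ X) :
    Nat.card (↥(integralCuspForms0 N 2 ⊓ ((ℂ ∙ D.f) ⊔ X).restrictScalars ℤ) ⧸
        ((ℤ ∙ D.f) ⊔ (integralCuspForms0 N 2 ⊓ X.restrictScalars ℤ)).comap
          (integralCuspForms0 N 2 ⊓ ((ℂ ∙ D.f) ⊔ X).restrictScalars ℤ).subtype) =
      Nat.card (↥(integralCuspForms0 N 2 ⊓ ((ℂ ∙ D'.f) ⊔ X').restrictScalars ℤ) ⧸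
        ((ℤ ∙ D'.f) ⊔ (integralCuspForms0 N 2 ⊓ X'.restrictScalars ℤ)).comap
          (integralCuspForms0 N 2 ⊓ ((ℂ ∙ D'.f) ⊔ X').restrictScalars ℤ).subtype) := by
  rw [f_eq_charTwist_twin_prime hpN hp2 C hC D D']
  exact natCard_blockQuotient_charTwist hpN _ (isPrimitive_quadraticChar_ringHomComp p hp2)
    (fun _ hn ↦ cuspCoeff_eq_zero_of_prime_dvd_of_isNewform0 hpN D.isNewformOf.1 hn) hX hX'

end PrimeTwist

/-- **BLOCK-TWIN at `p = 3` for a `χ₋₃`-twin curve pair** (`9 ∣ N`, `W' ≅ W ⊗ χ₋₃`, data `D`, `D'`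
at level `N`; `R` the twist by `(·/3)` on `S₂(Γ₀(N))`): for any `ℂ`-subspaces `X`, `X′` with
`R(X) ⊆ X′`, `R(X′) ⊆ X` the block quotients of `(D.f, X)` and `(D'.f, X′)` have the same order —
the T-F2 population (type III / III* optimal twin pairs at `9 ∥ N`; blocks = the reader's spans,
`O5/CongruenceBlockTwistDegeneracy.lean`). [cite: AgasheRibetStein2012, §2.1]
[cite: Shimura1971, Prop. 3.64] -/
theorem natCard_blockQuotient_twin_three {N : ℕ} [NeZero N] (h9 : 3 ^ 2 ∣ N)
    {W W' : WeierstrassCurve ℚ} [W.IsElliptic] [W'.IsElliptic] (C : VariableChange ℚ)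
    (hC : C • W.quadraticTwist (-3) = W') (D : ModularParametrizationData W N)
    (D' : ModularParametrizationData W' N) {X X' : Submodule ℂ (CuspForm (Gamma0 N) 2)}
    (hX : ∀ x ∈ X, charTwist N dvd_rfl h9 (isQuadratic_quadraticChar_ringHomComp 3) x ∈ X')
    (hX' : ∀ x ∈ X', charTwist N dvd_rfl h9 (isQuadratic_quadraticChar_ringHomComp 3) x ∈ X) :
    Nat.card (↥(integralCuspForms0 N 2 ⊓ ((ℂ ∙ D.f) ⊔ X).restrictScalars ℤ) ⧸
        ((ℤ ∙ D.f) ⊔ (integralCuspForms0 N 2 ⊓ X.restrictScalars ℤ)).comap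
          (integralCuspForms0 N 2 ⊓ ((ℂ ∙ D.f) ⊔ X).restrictScalars ℤ).subtype) =
      Nat.card (↥(integralCuspForms0 N 2 ⊓ ((ℂ ∙ D'.f) ⊔ X').restrictScalars ℤ) ⧸
        ((ℤ ∙ D'.f) ⊔ (integralCuspForms0 N 2 ⊓ X'.restrictScalars ℤ)).comap
          (integralCuspForms0 N 2 ⊓ ((ℂ ∙ D'.f) ⊔ X').restrictScalars ℤ).subtype) := by
  have hC' : C • W.quadraticTwist (pStarRat 3) = W' := by rwa [pStarRat_three]
  exact PrimeTwist.natCard_blockQuotient_twin_prime h9 (by norm_num) C hC' D D' hX hX'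

end Summit.BirchSwinnertonDyer.Rank1Residual.O5
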